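import Summits.Ventures.PercRepro.C025ProfileStarRule
/-!
# THE RULE `E*_u` — `(Cap)` ON THE INDEPENDENT `u`-SETS, BY CONSTRUCTION (night-3 g11)
`proofs/NIGHT3-G11-ESTAR.md`. On an independent `u`-set `S` (a set of `u` points of rank `u`) the rank-`2` subsets
are the `C(u,2)` pairs, every pair `B ⊆ S` has `S ∖ B ∈ G_B`, and rule `E*_u` pays each active pair its generic
share plus its granted request: the total is `(1 − φ(S)) + λ_S·Σ r ≤ 1` because the grant factor never exceeds the
freed capacity (`cap_wEstar_of_card_eq`). So the only content of the row `(2,u)` is `(Cap)` on the DEPENDENT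
rank-`u` sets.
-/
open scoped Matroid
namespace PercRepro
open Set Finset ThmH
namespace EStar
variable {α : Type} [DecidableEq α] {M : Matroid α} [M.Finite] {u : ℕ}

/-- On a set of `u` points of rank `u` (an independent `u`-set), the rank-`2` subsets are exactly the `2`-subsets. -/
theorem filter_Rq_eq_powersetCard_two {S : Finset α} (hS : S ∈ Shadow.levelSet M u) (hc : S.card = u) :
    (Profile.Rq M 2).filter (fun B => B ⊆ S) = S.powersetCard 2 := by
  obtain ⟨hSg, hSu⟩ := Profile.mem_levelSet.1 hS
  have hind : M.Indep (S : Set α) := by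
    rw [Matroid.indep_iff_eRk_eq_encard_of_finite (Finset.finite_toSet S), hSu,
      Set.encard_coe_eq_coe_finsetCard, hc]
  ext B
  rw [Finset.mem_filter, Profile.mem_Rq, Finset.mem_powersetCard]
  constructor
  · rintro ⟨⟨_, hB2⟩, hBS⟩
    refine ⟨hBS, ?_⟩
    have hBi : M.Indep (B : Set α) := hind.subset (by exact_mod_cast hBS)
    have := hBi.eRk_eq_encard
    rw [hB2, Set.encard_coe_eq_coe_finsetCard] at this
    exact_mod_cast this.symm
  · rintro ⟨hBS, hB2⟩
    refine ⟨⟨hBS.trans hSg, ?_⟩, hBS⟩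
    have hBi : M.Indep (B : Set α) := hind.subset (by exact_mod_cast hBS)
    rw [hBi.eRk_eq_encard, Set.encard_coe_eq_coe_finsetCard, hB2]

/-- For a `2`-subset `B` of an independent `u`-set `S`, `S ∖ B` is a good set of `B`. -/
theorem sdiff_mem_Gfam_of_indep {S B : Finset α} (hS : S ∈ Shadow.levelSet M u) (hc : S.card = u)
    (hB : B ∈ S.powersetCard 2) : S \ B ∈ Gfam M u B := by
  obtain ⟨hSg, hSu⟩ := Profile.mem_levelSet.1 hS
  rw [Finset.mem_powersetCard] at hB
  have hind : M.Indep (S : Set α) := by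
    rw [Matroid.indep_iff_eRk_eq_encard_of_finite (Finset.finite_toSet S), hSu,
      Set.encard_coe_eq_coe_finsetCard, hc]
  refine mem_Gfam.2 ⟨?_, ?_, ?_⟩
  · intro x hx
    rw [Finset.mem_sdiff] at hx
    refine mem_Fs.2 ⟨hSg hx.1, ?_⟩
    intro hxcl
    -- `B ∪ {x} ⊆ S` is independent with `3` points but `x ∈ cl B` gives rank `2`
    have hxcl' : x ∈ M.closure (B : Set α) := by rw [← coe_clF]; exact_mod_cast hxcl
    have h1 : M.eRk ((insert x B : Finset α) : Set α) = M.eRk (B : Set α) :=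
      eRk_insert_eq_of_mem_closure (hB.1.trans hSg) hxcl'
    have hBi : M.Indep ((insert x B : Finset α) : Set α) :=
      hind.subset (by exact_mod_cast Finset.insert_subset hx.1 hB.1)
    have h2 := hBi.eRk_eq_encard
    have h3 := (hind.subset (by exact_mod_cast hB.1 : (B : Set α) ⊆ S)).eRk_eq_encard
    rw [Set.encard_coe_eq_coe_finsetCard, Finset.card_insert_of_notMem hx.2, hB.2] at h2
    rw [Set.encard_coe_eq_coe_finsetCard, hB.2] at h3
    rw [h2, h3] at h1
    exact absurd h1 (by decide)
  · rw [Finset.card_sdiff_of_subset hB.1, hc, hB.2]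
  · rw [Finset.union_sdiff_of_subset hB.1, hSu]

/-- The sets of `P_B` and `Ls_B` have `u − 1` points, so `S ∖ B` (with `u − 2` points) is in neither. -/
theorem sdiff_notMem_Lfam_Pfam {S B : Finset α} (hc : (S \ B).card = u - 2) (hu : 2 ≤ u) :
    S \ B ∉ Lfam M u B ∧ S \ B ∉ Pfam M u B := by
  constructor
  · intro h
    have := card_of_mem_Lfam (M := M) h
    omega
  · intro h
    have := (mem_Pfam.1 h).2.1
    omega

/-- On an independent `u`-set, rule `E*_u` is the generic share plus the granted request of each active pair. -/
theorem wEstar_of_indep {S B : Finset α} (hu : 2 ≤ u) (hS : S ∈ Shadow.levelSet M u) (hc : S.card = u)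
    (hB : B ∈ S.powersetCard 2) :
    wEstar M u B S = if u ≤ crk M B then gsh M u B + req M u B * grant M u S else 0 := by
  have hG := sdiff_mem_Gfam_of_indep hS hc hB
  have hcard : (S \ B).card = u - 2 := (mem_Gfam.1 hG).2.1
  have hB2 : B.card = 2 := (Finset.mem_powersetCard.1 hB).2
  obtain ⟨hL, hP⟩ := sdiff_notMem_Lfam_Pfam (M := M) hcard hu
  unfold wEstar
  by_cases hcrk : crk M B < u
  · rw [if_pos hcrk, if_neg (not_le.2 hcrk)]
  · rw [if_neg hcrk, if_pos hB2, if_pos hG, if_pos (not_lt.1 hcrk)]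
    split_ifs <;> simp

/-- `Σ_{B ⊆ S active} g_B ≤ 1` on an independent `u`-set: the freed capacity is non-negative. -/
theorem freed_nonneg {S : Finset α} (hu : 2 ≤ u) (hc : S.card = u) : 0 ≤ freed M u S := by
  unfold freed
  have h1 : ∑ B ∈ actPairs M u S, gsh M u B ≤ ∑ _B ∈ S.powersetCard 2, cap u := by
    calc ∑ B ∈ actPairs M u S, gsh M u B ≤ ∑ B ∈ actPairs M u S, cap u :=
          Finset.sum_le_sum (fun B _ => gsh_le_cap B)
      _ ≤ ∑ _B ∈ S.powersetCard 2, cap u :=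
          Finset.sum_le_sum_of_subset_of_nonneg (Finset.filter_subset _ _) (fun _ _ _ => cap_nonneg)
  rw [Finset.sum_const, nsmul_eq_mul, Finset.card_powersetCard, hc] at h1
  have h2 : ((Nat.choose u 2 : ℕ) : ℚ) * cap u = 1 := by
    unfold cap
    have : (Nat.choose u 2 : ℚ) ≠ 0 := by exact_mod_cast (Nat.choose_pos hu).ne'
    field_simp
  linarith

/-- **`(Cap)` of rule `E*_u` on the independent `u`-sets, by construction.** -/
theorem cap_wEstar_of_card_eq {S : Finset α} (hu : 2 ≤ u) (hS : S ∈ Shadow.levelSet M u) (hc : S.card = u) :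
    ∑ B ∈ (Profile.Rq M 2).filter (fun B => B ⊆ S), wEstar M u B S ≤ 1 := by
  rw [filter_Rq_eq_powersetCard_two hS hc]
  rw [Finset.sum_congr rfl (fun B hB => wEstar_of_indep hu hS hc hB)]
  rw [← Finset.sum_filter]
  have hsum : ∑ B ∈ actPairs M u S, (gsh M u B + req M u B * grant M u S) =
      (1 - freed M u S) + grant M u S * reqsum M u S := by
    unfold freed reqsum
    rw [Finset.sum_add_distrib, Finset.mul_sum]
    have : ∑ B ∈ actPairs M u S, req M u B * grant M u S = ∑ B ∈ actPairs M u S, grant M u S * req M u B :=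
      Finset.sum_congr rfl (fun B _ => mul_comm _ _)
    rw [this]; ring
  change ∑ B ∈ actPairs M u S, (gsh M u B + req M u B * grant M u S) ≤ 1
  rw [hsum]
  have hf := freed_nonneg (M := M) hu hc
  have hr := reqsum_nonneg (M := M) (u := u) S
  unfold grant
  split_ifs with h
  · linarith
  · push Not at h
    have hrpos : 0 < reqsum M u S := lt_of_le_of_lt hf h
    rw [max_eq_right (div_nonneg hf hrpos.le), div_mul_cancel₀ _ hrpos.ne']
    linarith


end EStar
end PercRepro
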